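import Literature.Barriers.CriticalPhenomena.RigorousRGSmallParameterPolymers
import HarnessLib

/-!
# `RigorousRGSmallParameter` (Slade, Theorem 1.4.1): torus `ℓ^∞` geometry — cyclic distance,
# diameter of connected polymers and small sets, separation of non-touching `(j+1)`-polymers

Companion ("proof architecture") file of
`Literature/Barriers/CriticalPhenomena/RigorousRGSmallParameter.lean`. The renormalisation
group step behind Slade's Theorem 6.3.1 (iterated in the named fact `Slade2017_prop822`) uses the
finite range of the fluctuation covariance — "The covariances obey the finite-range property that
`C_j(x,y) = 0` for `|x-y| ≥ ½L^j`" with `|·|` "the `ℓ_∞` distance on both `ℤ^d` and the torus `Λ`"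
([BS-rg-step] §1.2–1.3) — only through the factorisation property of `𝔼_{j+1}θ` over products of
`F_m(X_m) ∈ 𝒩(X_m)` for `(j+1)`-polymers `X_m` that "do not touch" (`min{|x-y|_∞} > 1`,
[BS-rg-step] §1.2 Definition (c)); in the proofs the factors in fact live on scale-`j` small-set
neighbourhoods `X^□` of such polymers (e.g. `θK(X) ∈ 𝒩(X^□)`, Slade Definition 6.1.2). This file
supplies the elementary metric geometry of the discrete torus `(ℤ/Mℤ)^d` that turns
"non-touching at scale `L^{j+1}`" into "farther apart than the range `½L^{j+1}`" (all proved):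

* `fdist`, `cycDist` (cyclic distance on `ℤ/Mℤ`, `cycDist_triangle`), `tdist` (the `ℓ^∞` torus
  distance, `tdist_triangle`, `tdist_le_one_of_adjInf`);
* **`tdist_lt_of_isConn`**: two points of a connected `b`-polymer `Y` satisfy
  `|x-u|_∞ < |ℬ_b(Y)|·b` (discrete intermediate values along an `ℓ^∞`-path,
  `exists_cycDist_eq_of_connIn`, and `|{z_i : z ∈ Y}| ≤ |ℬ_b(Y)|·b`); hence
  **`exists_tdist_lt_of_mem_sclosure`**: every point of `X^□` is within `< 2^d b` of `X`;
* **`lt_tdist_of_forall_not_adj`**: for `b' ∣ M`, two `b'`-polymers with no equal or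
  `ℓ^∞`-adjacent pair of points (i.e. which do not touch) have all their points at torus distance
  `> b'` (coordinatewise construction of a touching pair of points in the two blocks otherwise,
  `exists_key_pair_of_cycDist_le`);
* **`apply_eq_zero_of_subset_sclosure`**: consequently a kernel `C` with `C(x,y) = 0` for
  `|x-y|_∞ ≥ r` vanishes between `D₁ ⊆ U₁^□` and `D₂ ⊆ U₂^□` (scale-`b` neighbourhoods of
  non-touching `b'`-polymers) as soon as `r + 2^{d+1} b ≤ b' + 1` — for `r = ½L^{j+1}`,
  `b = L^j`, `b' = L^{j+1}` this is `L ≥ 2^{d+2}` ("`L` sufficiently large").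

Sources: D. C. Brydges, G. Slade, J. Stat. Phys. 159 (2015) 589–667, arXiv:1403.7256, §1.2
(Definition: blocks, connectivity, "do not touch"), §1.3 (finite range, factorisation property);
G. Slade, arXiv:1611.06169, §3 (display (3.3), range `½L^j`), §6.1 (`X^□`).

## References

* [BrydgesSlade2015RGV] D. C. Brydges, G. Slade, *A renormalisation group method. V. A single
  renormalisation group step*, J. Stat. Phys. **159** (2015) 589–667, arXiv:1403.7256.
* [Slade2017] G. Slade, *Critical exponents for long-range O(n) models below the upper critical
  dimension*, Commun. Math. Phys. **358** (2018) 343–436, arXiv:1611.06169.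
-/

noncomputable section

open Finset

namespace Literature.Barriers.CriticalPhenomena

namespace LongRangePhi4

namespace Polymer

open Literature.Probability.LatticeModels

variable {d M : ℕ}

/-! ### Cyclic distance on `ℤ/Mℤ` and the `ℓ^∞` torus distance -/

/-- Forward (counter-clockwise) step count from `a` to `c` on `ℤ/Mℤ`. [folklore] -/
def fdist (a c : ZMod M) : ℕ := (c - a).val

/-- Cyclic distance on `ℤ/Mℤ`. [folklore] -/
def cycDist (a c : ZMod M) : ℕ := min (fdist a c) (fdist c a)

/-- `cycDist` is symmetric. [folklore] -/
theorem cycDist_comm (a c : ZMod M) : cycDist a c = cycDist c a := min_comm _ _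

/-- `cycDist a a = 0`. [folklore] -/
@[simp] theorem cycDist_self (a : ZMod M) : cycDist a a = 0 := by simp [cycDist, fdist]

variable [NeZero M]

omit [NeZero M] in
/-- Triangle inequality for forward steps. [folklore] -/
theorem fdist_triangle (a e c : ZMod M) : fdist a c ≤ fdist a e + fdist e c := by
  unfold fdist
  have : c - a = (e - a) + (c - e) := by ring
  rw [this]
  exact ZMod.val_add_le _ _

/-- Forward and backward steps add up to `M` (for `a ≠ c`). [folklore] -/
theorem fdist_add_fdist {a c : ZMod M} (h : a ≠ c) : fdist a c + fdist c a = M := by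
  unfold fdist
  have hne : c - a ≠ 0 := sub_ne_zero.2 (Ne.symm h)
  have e : a - c = -(c - a) := by ring
  rw [e, ZMod.neg_val, if_neg hne]
  have := ZMod.val_lt (c - a)
  omega

/-- `fdist a c < M`. [folklore] -/
theorem fdist_lt (a c : ZMod M) : fdist a c < M := ZMod.val_lt _

/-- Forward steps compose modulo `M`: `fdist a e = (fdist a c + fdist c e) mod M`. [folklore] -/
theorem fdist_eq_add_mod (a c e : ZMod M) : fdist a e = (fdist a c + fdist c e) % M := by
  unfold fdist
  have : e - a = (c - a) + (e - c) := by ring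
  rw [this, ZMod.val_add]

omit [NeZero M] in
/-- `s mod M` for `s < 2M`. [folklore] -/
theorem mod_eq_or_of_lt_two_mul {s M : ℕ} (hs : s < 2 * M) : s % M = s ∨ s % M + M = s := by
  by_cases h : s < M
  · exact Or.inl (Nat.mod_eq_of_lt h)
  · right
    have hM : M ≤ s := Nat.le_of_not_lt h
    rw [Nat.mod_eq_sub_mod hM, Nat.mod_eq_of_lt (by omega)]
    omega

/-- **Triangle inequality for the cyclic distance.** [folklore] -/
theorem cycDist_triangle (a e c : ZMod M) : cycDist a c ≤ cycDist a e + cycDist e c := by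
  by_cases hac : a = c
  · subst hac; simp
  unfold cycDist
  have h1 := fdist_triangle a e c
  have h2 := fdist_triangle c e a
  have hM := fdist_add_fdist hac
  have hlt1 := fdist_lt a c
  have hlt2 := fdist_lt c e
  have hlt3 := fdist_lt e a
  rcases le_total (fdist a e) (fdist e a) with hae | hae <;> rcases le_total (fdist e c) (fdist c e) with hec | hec
  · rw [min_eq_left hae, min_eq_left hec]
    exact (min_le_left _ _).trans h1
  · -- `e` ahead of both `a` and `c`
    rw [min_eq_left hae, min_eq_right hec]
    have hmod := fdist_eq_add_mod a c e
    rcases mod_eq_or_of_lt_two_mul (s := fdist a c + fdist c e) (M := M) (by omega) with h | h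
    · rw [h] at hmod
      exact (min_le_left _ _).trans (by omega)
    · rw [← hmod] at h
      exact (min_le_right _ _).trans (by omega)
  · -- `e` behind both `a` and `c`
    rw [min_eq_right hae, min_eq_left hec]
    have hmod := fdist_eq_add_mod e a c
    rcases mod_eq_or_of_lt_two_mul (s := fdist e a + fdist a c) (M := M) (by omega) with h | h
    · rw [h] at hmod
      exact (min_le_left _ _).trans (by omega)
    · rw [← hmod] at h
      exact (min_le_right _ _).trans (by omega)
  · rw [min_eq_right hae, min_eq_right hec]
    exact (min_le_right _ _).trans (by omega)

omit [NeZero M] in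
/-- One step changes the cyclic distance by at most one: `cycDist a (a+1) ≤ 1`. [folklore] -/
theorem cycDist_add_one_le (a : ZMod M) : cycDist a (a + 1) ≤ 1 := by
  unfold cycDist fdist
  refine (min_le_left _ _).trans ?_
  rw [add_sub_cancel_left, ZMod.val_one_eq_one_mod]
  exact Nat.mod_le 1 M

omit [NeZero M] in
/-- `ℓ^∞`-neighbours are at cyclic distance `≤ 1` in every coordinate. [folklore] -/
theorem cycDist_le_one_of_adjInf {x y : TorusSite d M} (h : AdjInf x y) (i : Fin d) : cycDist (x i) (y i) ≤ 1 := by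
  rcases h.2 i with e | e | e
  · rw [e, cycDist_self]; exact Nat.zero_le _
  · rw [e]; exact cycDist_add_one_le _
  · rw [cycDist_comm, e]; exact cycDist_add_one_le _

/-- The `ℓ^∞` torus distance `|x - y|_∞` (max over coordinates of the cyclic distances). [cite: BrydgesSlade2015RGV, §1.2 ("We write |·| for the ℓ_∞ distance on both ℤ^d and the torus Λ")] -/
def tdist (x y : TorusSite d M) : ℕ := univ.sup fun i => cycDist (x i) (y i)

omit [NeZero M] in
/-- Coordinates are bounded by `tdist`. [folklore] -/
theorem cycDist_le_tdist (x y : TorusSite d M) (i : Fin d) : cycDist (x i) (y i) ≤ tdist x y :=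
  Finset.le_sup (f := fun i => cycDist (x i) (y i)) (mem_univ i)

omit [NeZero M] in
/-- `tdist x y ≤ m` iff every coordinate is within `m`. [folklore] -/
theorem tdist_le_iff {x y : TorusSite d M} {m : ℕ} : tdist x y ≤ m ↔ ∀ i, cycDist (x i) (y i) ≤ m := by
  simp [tdist, Finset.sup_le_iff]

omit [NeZero M] in
/-- `tdist` is symmetric. [folklore] -/
theorem tdist_comm (x y : TorusSite d M) : tdist x y = tdist y x := by
  unfold tdist
  congr 1
  funext i
  exact cycDist_comm _ _

omit [NeZero M] in
/-- `tdist x x = 0`. [folklore] -/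
@[simp] theorem tdist_self (x : TorusSite d M) : tdist x x = 0 := by
  apply le_antisymm _ (Nat.zero_le _)
  exact tdist_le_iff.2 fun i => by simp

/-- **Triangle inequality for the torus distance.** [folklore] -/
theorem tdist_triangle (x z y : TorusSite d M) : tdist x y ≤ tdist x z + tdist z y :=
  tdist_le_iff.2 fun i => (cycDist_triangle (x i) (z i) (y i)).trans
    (add_le_add (cycDist_le_tdist x z i) (cycDist_le_tdist z y i))

omit [NeZero M] in
/-- `ℓ^∞`-neighbours are at torus distance `≤ 1`. [folklore] -/
theorem tdist_le_one_of_adjInf {x y : TorusSite d M} (h : AdjInf x y) : tdist x y ≤ 1 :=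
  tdist_le_iff.2 (cycDist_le_one_of_adjInf h)

/-! ### Diameter of a connected polymer -/

/-- Along a path inside `Y` from `x`, every cyclic distance up to that of the endpoint is realised
by a point of `Y` (discrete intermediate values), coordinatewise. [folklore] -/
theorem exists_cycDist_eq_of_connIn {Y : Finset (TorusSite d M)} {x u : TorusSite d M} (hx : x ∈ Y)
    (h : ConnIn Y x u) (i : Fin d) : ∀ k ≤ cycDist (x i) (u i), ∃ z ∈ Y, cycDist (x i) (z i) = k := by
  unfold ConnIn at h
  induction h with
  | refl =>
    intro k hk
    rw [cycDist_self] at hk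
    exact ⟨x, hx, by rw [cycDist_self]; exact (Nat.le_zero.1 hk).symm⟩
  | @tail w z _ hwz ih =>
    intro k hk
    obtain ⟨-, hzY, hadj⟩ := hwz
    have hstep : cycDist (x i) (z i) ≤ cycDist (x i) (w i) + 1 :=
      (cycDist_triangle (x i) (w i) (z i)).trans (Nat.add_le_add_left (cycDist_le_one_of_adjInf hadj i) _)
    by_cases hk' : k ≤ cycDist (x i) (w i)
    · exact ih k hk'
    · refine ⟨z, hzY, ?_⟩
      omega

/-- **Diameter bound, coordinatewise**: two points of a connected set `Y` are within cyclic
distance `< |{z_i : z ∈ Y}|` in coordinate `i`. [folklore] -/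
theorem cycDist_lt_card_image {Y : Finset (TorusSite d M)} (hY : IsConn Y) {x u : TorusSite d M} (hx : x ∈ Y)
    (hu : u ∈ Y) (i : Fin d) : cycDist (x i) (u i) < (Y.image fun z => z i).card := by
  classical
  have hpath := exists_cycDist_eq_of_connIn hx (hY.2 x hx u hu) i
  -- the distances `0, …, D` are all realised, by distinct coordinate values
  have hsub : Finset.range (cycDist (x i) (u i) + 1) ⊆ (Y.image fun z => z i).image (cycDist (x i)) := by
    intro k hk
    rw [Finset.mem_range] at hk
    obtain ⟨z, hz, hzk⟩ := hpath k (by omega)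
    exact mem_image.2 ⟨z i, mem_image_of_mem (fun z => z i) hz, hzk⟩
  have h1 := Finset.card_le_card hsub
  rw [Finset.card_range] at h1
  have h2 : ((Y.image fun z => z i).image (cycDist (x i))).card ≤ (Y.image fun z => z i).card := Finset.card_image_le
  omega

/-- A residue class of block keys in one coordinate has at most `b` elements:
`|{v ∈ ℤ/Mℤ : ⌊v/b⌋ = κ}| ≤ b`. [folklore] -/
theorem card_filter_div_eq_le (b κ : ℕ) (hb : 0 < b) (S : Finset (ZMod M)) :
    (S.filter fun v => v.val / b = κ).card ≤ b := by
  classical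
  have hinj : Set.InjOn (fun v : ZMod M => v.val) ↑(S.filter fun v => v.val / b = κ) :=
    fun v _ w _ hvw => ZMod.val_injective M hvw
  have hmaps : ∀ v ∈ S.filter (fun v => v.val / b = κ), (fun v : ZMod M => v.val) v ∈ Finset.Ico (κ * b) (κ * b + b) := by
    intro v hv
    obtain ⟨-, hv⟩ := mem_filter.1 hv
    rw [Finset.mem_Ico]
    constructor
    · rw [← hv]; exact Nat.div_mul_le_self _ _
    · rw [← hv]
      have := Nat.lt_div_mul_add (a := v.val) hb
      linarith [Nat.div_mul_le_self v.val b]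
  have := Finset.card_le_card_of_injOn (fun v : ZMod M => v.val) hmaps hinj
  simpa using this

/-- The coordinate projection of a `b`-polymer has at most `|ℬ(Y)| · b` values. [folklore] -/
theorem card_image_apply_le {b : ℕ} (hb : 0 < b) {Y : Finset (TorusSite d M)} (i : Fin d) :
    (Y.image fun z => z i).card ≤ numBlocks b Y * b := by
  classical
  set S := Y.image fun z => z i with hS
  set keys := Y.image fun z => blockKey b z with hkeys
  -- `S` is covered by the fibres over the `i`-th components of the keys
  have hcover : S = (keys.image fun κ => κ i).biUnion fun k => S.filter fun v => v.val / b = k := by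
    ext v
    simp only [mem_biUnion, mem_image, mem_filter, hS, hkeys]
    constructor
    · rintro ⟨z, hz, rfl⟩
      exact ⟨blockKey b z i, ⟨blockKey b z, ⟨z, hz, rfl⟩, rfl⟩, ⟨z, hz, rfl⟩, rfl⟩
    · rintro ⟨-, -, h, -⟩
      exact h
  have h1 : S.card ≤ ∑ k ∈ keys.image (fun κ => κ i), (S.filter fun v => v.val / b = k).card := by
    conv_lhs => rw [hcover]
    exact Finset.card_biUnion_le
  have h2 : ∑ k ∈ keys.image (fun κ => κ i), (S.filter fun v => v.val / b = k).card ≤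
      (keys.image fun κ => κ i).card * b := by
    have := Finset.sum_le_card_nsmul (keys.image fun κ => κ i) (fun k => (S.filter fun v => v.val / b = k).card) b
      fun k _ => card_filter_div_eq_le b k hb S
    simpa using this
  have h3 : (keys.image fun κ => κ i).card ≤ keys.card := Finset.card_image_le
  -- `keys` is in bijection with the blocks of `Y`
  have h4 : keys.card = numBlocks b Y := by
    unfold numBlocks blocksOf
    rw [hkeys]
    refine Finset.card_bij (fun κ _ => univ.filter fun y => blockKey b y = κ) ?_ ?_ ?_
    · intro κ hκ
      obtain ⟨z, hz, rfl⟩ := mem_image.1 hκ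
      exact mem_image.2 ⟨z, hz, rfl⟩
    · intro κ hκ κ' _ h
      obtain ⟨z, -, rfl⟩ := mem_image.1 hκ
      have hz : z ∈ univ.filter fun y : TorusSite d M => blockKey b y = blockKey b z := by simp
      rw [h] at hz
      simpa using hz
    · intro B hB
      obtain ⟨z, hz, rfl⟩ := mem_image.1 hB
      exact ⟨blockKey b z, mem_image.2 ⟨z, hz, rfl⟩, rfl⟩
  calc S.card ≤ _ := h1
    _ ≤ (keys.image fun κ => κ i).card * b := h2
    _ ≤ keys.card * b := Nat.mul_le_mul_right b h3
    _ = numBlocks b Y * b := by rw [h4]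

/-- **Diameter of a connected polymer**: two points of a connected `b`-polymer with `|ℬ(Y)|`
blocks are at torus distance `< |ℬ(Y)| · b`; in particular points of a small set are within
`2^d L^j`. [folklore] -/
theorem tdist_lt_of_isConn {b : ℕ} (hb : 0 < b) {Y : Finset (TorusSite d M)} (hY : IsConn Y) {x u : TorusSite d M}
    (hx : x ∈ Y) (hu : u ∈ Y) (hd : 0 < d) : tdist x u < numBlocks b Y * b := by
  have h : ∀ i, cycDist (x i) (u i) < numBlocks b Y * b := fun i =>
    (cycDist_lt_card_image hY hx hu i).trans_le (card_image_apply_le hb i)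
  obtain ⟨i, -, hi⟩ := Finset.exists_mem_eq_sup (univ : Finset (Fin d)) ⟨⟨0, hd⟩, mem_univ _⟩
    fun i => cycDist (x i) (u i)
  unfold tdist
  rw [hi]
  exact h i

/-- Points of `X^□` (scale `b`) are within torus distance `< 2^d b` of `X`. [folklore] -/
theorem exists_tdist_lt_of_mem_sclosure {b : ℕ} (hb : 0 < b) (hd : 0 < d) {X : Finset (TorusSite d M)}
    {x : TorusSite d M} (hx : x ∈ sclosure b X) : ∃ u ∈ X, tdist x u < 2 ^ d * b := by
  obtain ⟨Y, hY, ⟨u, hu⟩, hxY⟩ := mem_sclosure.1 hx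
  rw [mem_inter] at hu
  refine ⟨u, hu.1, (tdist_lt_of_isConn hb hY.2.1 hxY hu.2 hd).trans_le ?_⟩
  exact Nat.mul_le_mul_right b hY.2.2

/-! ### Non-touching coarse polymers are far apart -/

omit [NeZero M] in
/-- Natural-number casts into `ℤ/Mℤ` below `M` keep their value. [folklore] -/
theorem val_natCast_of_lt {k : ℕ} (hk : k < M) : ((k : ℕ) : ZMod M).val = k := by
  rw [ZMod.val_natCast, Nat.mod_eq_of_lt hk]

omit [NeZero M] in
/-- Division by explicit bounds: `k b ≤ x < k b + b ⇒ x / b = k`. [folklore] -/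
theorem div_eq_of_bounds {x k b : ℕ} (hb : 0 < b) (h1 : k * b ≤ x) (h2 : x < k * b + b) : x / b = k := by
  apply le_antisymm
  · exact Nat.lt_succ_iff.1 ((Nat.div_lt_iff_lt_mul hb).2 (by rw [Nat.succ_mul]; exact h2))
  · exact (Nat.le_div_iff_mul_le hb).2 h1

/-- One coordinate of the touching construction: if `c` is at most `b'` forward steps from `a`
(`b' ∣ M`), there are `p, q` in the `b'`-key classes of `a, c` with `q = p` or `q = p + 1`. [folklore] -/
theorem exists_key_pair_of_fdist_le {b' : ℕ} (hb : 0 < b') (hbM : b' ∣ M) {a c : ZMod M} (h : fdist a c ≤ b') :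
    ∃ p q : ZMod M, p.val / b' = a.val / b' ∧ q.val / b' = c.val / b' ∧ (q = p ∨ q = p + 1) := by
  have hMpos : 0 < M := Nat.pos_of_ne_zero (NeZero.ne M)
  obtain ⟨m, hm⟩ := hbM
  have hca : c = a + (c - a) := by ring
  have hcval : c.val = (a.val + fdist a c) % M := by
    conv_lhs => rw [hca]
    rw [ZMod.val_add]
    rfl
  have haM := ZMod.val_lt a
  have hcM := ZMod.val_lt c
  generalize ht : fdist a c = t at h hcval
  have htlt : t < M := ht ▸ fdist_lt a c
  set κ := a.val / b' with hκ
  have hκle : κ * b' ≤ a.val := Nat.div_mul_le_self _ _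
  have hκlt : a.val < κ * b' + b' := by rw [hκ]; exact Nat.lt_div_mul_add hb
  set kb := κ * b' with hkb
  by_cases hwrap : a.val + t < M
  · rw [Nat.mod_eq_of_lt hwrap] at hcval
    by_cases hsame : c.val / b' = κ
    · exact ⟨a, a, rfl, by rw [hsame], Or.inl rfl⟩
    · -- then `c` lies in the next class `κ + 1`
      have hcge : kb + b' ≤ c.val := by
        by_contra hlt
        exact hsame (div_eq_of_bounds hb (by omega) (by omega))
      have hclt : c.val < kb + b' + b' := by omega
      have hcdiv : c.val / b' = κ + 1 := div_eq_of_bounds hb (by rw [Nat.add_mul, one_mul]; exact hcge)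
        (by rw [Nat.add_mul, one_mul]; exact hclt)
      have hlt1 : kb + b' - 1 < M := by omega
      have hlt2 : kb + b' < M := by omega
      refine ⟨((kb + b' - 1 : ℕ) : ZMod M), ((kb + b' - 1 : ℕ) : ZMod M) + 1, ?_, ?_, Or.inr rfl⟩
      · rw [val_natCast_of_lt hlt1]
        exact div_eq_of_bounds hb (by omega) (by omega)
      · have e : ((kb + b' - 1 : ℕ) : ZMod M) + 1 = ((kb + b' : ℕ) : ZMod M) := by
          rw [← Nat.cast_add_one, Nat.sub_add_cancel (by omega : 1 ≤ kb + b')]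
        rw [e, val_natCast_of_lt hlt2, hcdiv]
        exact div_eq_of_bounds hb (by rw [Nat.add_mul, one_mul]) (by rw [Nat.add_mul, one_mul]; omega)
  · -- wrap around: `c` is in class `0`, `a` in the last class `m - 1`
    push Not at hwrap
    have htM : t ≤ b' := h
    have hcval' : c.val = a.val + t - M := by
      rw [hcval, Nat.mod_eq_sub_mod hwrap, Nat.mod_eq_of_lt (by omega)]
    have hclt : c.val < b' := by
      rw [hcval']
      exact Nat.sub_lt_left_of_lt_add hwrap (by omega)
    have hc0 : c.val / b' = 0 := Nat.div_eq_of_lt hclt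
    obtain ⟨m', rfl⟩ : ∃ m', m = m' + 1 := by
      rcases Nat.eq_zero_or_pos m with h0 | h0
      · rw [h0, mul_zero] at hm; omega
      · exact ⟨m - 1, by omega⟩
    have hMeq : m' * b' + b' = M := by rw [hm]; ring
    have hadiv : a.val / b' = m' := div_eq_of_bounds hb (by omega) (by omega)
    have hlt1 : M - 1 < M := by omega
    refine ⟨((M - 1 : ℕ) : ZMod M), ((M - 1 : ℕ) : ZMod M) + 1, ?_, ?_, Or.inr rfl⟩
    · rw [val_natCast_of_lt hlt1, hκ, hadiv]
      exact div_eq_of_bounds hb (by omega) (by omega)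
    · have e : ((M - 1 : ℕ) : ZMod M) + 1 = 0 := by
        rw [← Nat.cast_add_one, Nat.sub_add_cancel hMpos, ZMod.natCast_self]
      rw [e, ZMod.val_zero, hc0, Nat.zero_div]

/-- One coordinate, symmetric form: `cycDist a c ≤ b'` gives a key-compatible `ℓ^∞`-adjacent
pair. [folklore] -/
theorem exists_key_pair_of_cycDist_le {b' : ℕ} (hb : 0 < b') (hbM : b' ∣ M) {a c : ZMod M} (h : cycDist a c ≤ b') :
    ∃ p q : ZMod M, p.val / b' = a.val / b' ∧ q.val / b' = c.val / b' ∧ (q = p ∨ q = p + 1 ∨ p = q + 1) := by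
  unfold cycDist at h
  rcases min_le_iff.1 h with h | h
  · obtain ⟨p, q, hp, hq, hpq⟩ := exists_key_pair_of_fdist_le hb hbM h
    exact ⟨p, q, hp, hq, by tauto⟩
  · obtain ⟨p, q, hp, hq, hpq⟩ := exists_key_pair_of_fdist_le hb hbM h
    refine ⟨q, p, hq, hp, ?_⟩
    rcases hpq with h | h
    · exact Or.inl h.symm
    · exact Or.inr (Or.inr h)

/-- **Non-touching coarse polymers are more than a block apart**: if `b' ∣ M` and the
`b'`-polymers `U₁, U₂` contain no pair of equal or `ℓ^∞`-adjacent points, then all their points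
are at torus distance `> b'` ("two polymers `X, Y` do not touch if `min{|x-y|_∞} > 1`"; as unions
of blocks of side `L^{j+1}` they are then separated by whole blocks). [cite: BrydgesSlade2015RGV, §1.2, Definition (c) (polymers that do not touch)] -/
theorem lt_tdist_of_forall_not_adj {b' : ℕ} (hb : 0 < b') (hbM : b' ∣ M) {U₁ U₂ : Finset (TorusSite d M)}
    (hU₁ : IsPolymer b' U₁) (hU₂ : IsPolymer b' U₂)
    (h : ∀ p ∈ U₁, ∀ q ∈ U₂, ¬ (p = q ∨ AdjInf p q)) {u v : TorusSite d M} (hu : u ∈ U₁) (hv : v ∈ U₂) :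
    b' < tdist u v := by
  by_contra hle
  push Not at hle
  have hcoord : ∀ i, ∃ pq : ZMod M × ZMod M, pq.1.val / b' = (u i).val / b' ∧ pq.2.val / b' = (v i).val / b' ∧
      (pq.2 = pq.1 ∨ pq.2 = pq.1 + 1 ∨ pq.1 = pq.2 + 1) := fun i => by
    obtain ⟨p, q, hp, hq, hpq⟩ := exists_key_pair_of_cycDist_le hb hbM ((cycDist_le_tdist u v i).trans hle)
    exact ⟨(p, q), hp, hq, hpq⟩
  choose pq hpq using hcoord
  have hpU : (fun i => (pq i).1) ∈ U₁ := by
    refine hU₁ hu ?_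
    rw [mem_block]
    funext i
    exact (hpq i).1
  have hqU : (fun i => (pq i).2) ∈ U₂ := by
    refine hU₂ hv ?_
    rw [mem_block]
    funext i
    exact (hpq i).2.1
  refine h _ hpU _ hqU ?_
  by_cases hpq' : (fun i => (pq i).1) = (fun i => (pq i).2)
  · exact Or.inl hpq'
  · exact Or.inr ⟨hpq', fun i => (hpq i).2.2⟩

/-- **Separation for the factorisation property**: if `D_k ⊆ U_k^□` (scale-`b` small-set
neighbourhoods) for `b'`-polymers `U₁, U₂` without touching points (`b' ∣ M`), then every
`x ∈ D₁`, `y ∈ D₂` are at torus distance `> b' - 2·2^d b`; so a kernel of `ℓ^∞`-range `r` with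
`r + 2^{d+1} b ≤ b' + 1` (e.g. `r = ½L^{j+1}`, `b' = L b`, `L ≥ 2^{d+2}`) vanishes between `D₁`
and `D₂`. [cite: BrydgesSlade2015RGV, §1.3 ("C_j(x,y) = 0 for |x-y| ≥ ½L^j … if X_1,…,X_n ∈ 𝒫_{j+1} do not touch … factorisation property")] -/
theorem apply_eq_zero_of_subset_sclosure {b b' r : ℕ} (hb : 0 < b) (hb' : 0 < b') (hbM : b' ∣ M) (hd : 0 < d)
    (hL : r + 2 * (2 ^ d * b) ≤ b' + 1) {β : Type*} [Zero β] {C : TorusSite d M → TorusSite d M → β}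
    (hC : ∀ x y, r ≤ tdist x y → C x y = 0) {U₁ U₂ D₁ D₂ : Finset (TorusSite d M)}
    (hU₁ : IsPolymer b' U₁) (hU₂ : IsPolymer b' U₂) (h : ∀ p ∈ U₁, ∀ q ∈ U₂, ¬ (p = q ∨ AdjInf p q))
    (hD₁ : D₁ ⊆ sclosure b U₁) (hD₂ : D₂ ⊆ sclosure b U₂) :
    ∀ x ∈ D₁, ∀ y ∈ D₂, C x y = 0 := by
  intro x hx y hy
  obtain ⟨u, hu, hxu⟩ := exists_tdist_lt_of_mem_sclosure hb hd (hD₁ hx)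
  obtain ⟨v, hv, hyv⟩ := exists_tdist_lt_of_mem_sclosure hb hd (hD₂ hy)
  have huv := lt_tdist_of_forall_not_adj hb' hbM hU₁ hU₂ h hu hv
  have h1 := tdist_triangle u x v
  have h2 := tdist_triangle x y v
  rw [tdist_comm u x] at h1
  refine hC x y ?_
  set g := 2 ^ d * b with hg
  omega

end Polymer

end LongRangePhi4

end Literature.Barriers.CriticalPhenomena
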